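import Summits.QuantumFields.BalabanUV.T4Continuum.Support.NE7FlatGradientModulusPrep
import HarnessLib

/-!
# NE7FlatKernelRowModulus — THE DIPOLE-KERNEL ROW MODULUS `Σ_{y ∈ cube c (R+1)} |∇_μG₀(x − y) − ∇_μG₀(x′ − y)| ≤ C·h·(1 + log⁺((R+1)∕h))`, `h = |x − x′|_∞`,
# and the LOG-LIPSCHITZ MODULUS OF THE GRADIENT OF A COMPACTLY SUPPORTED SCALAR LATTICE FUNCTION WITH BOUNDED LAPLACIAN
# (file F1 of gen 112's line «flat interior C^{1,log-Lip} potential theory + (10) ⟹ (9)_{β<1}»)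

Cell `pub-balaban`, rung (B)+1 sub-cell t4, lineage `b2b-balaban-t4-ne7-p1` (CRUX PROVER NE7 #1 = OWNER of BINDER row NE7), generation 112.  Memo
`t4/b2b-balaban-t4-ne7-p1-g112/ROAD-G112.md`.  Consumed by F2 `NE7FlatInteriorGradientModulus` (the INTERIOR log-Lipschitz modulus of `∇u` for any lattice
function `u` with bounded flat Laplacian on a cube — the analytic step from a log-free LAPLACIAN bound of type [Balaban1985Variational] Thm 1 (10) to the Hölder
clause of (9) for every `β < 1`, uniformly in the cube size).
THE MECHANISM ([folklore] discrete potential theory over pv23's `Beta/PoissonInterior` and NE7b g154's bricks `NE7FlatGradientModulusPrep`, KERNEL).  §1 isolates,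
as a standalone real estimate, the kernel row that g154's `NE7FlatGradientModulusCompact.gradient_modulus_cube` evaluates inside its proof: for the dipole kernel
`K = dG₀ μ` (`|K(v)| ≤ C₁·nrm(v)^{1−d}`, `G₀_diff_bound`) and two points `x, x′` with `|x′ − c|_∞ ≤ 2R + 2`, the row `Σ_{y ∈ cube c (R+1)} |K(x−y) − K(x′−y)|` splits into
the NEAR FIELD `|x′ − y|_∞ < 2h` (both kernels separately: two dipole row sums over cubes of radius `3h`, `2h`, `sum_cube_inv_nrm_pow_le` — `O(h)`) and the FAR FIELD
`|x′ − y|_∞ ≥ 2h` (`|K(v + w) − K(v)| ≤ |w|₁·C₂·2^d·nrm(v)^{−d}`, `abs_dG₀_add_sub_le`, summed over the shells `2h ≤ |z|_∞ ≤ 3R+3` with the logarithmic shell sum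
`sum_cube_far_inv_nrm_pow_le` — `O(h·(1 + log⁺((R+1)∕h)))`).  §2: a scalar `w` vanishing off `cube c R` IS the Newtonian potential of `−Δw` (pv23's `green_rep`), so
`∇_μw(x) − ∇_μw(x′) = −Σ_y [K(x−y) − K(x′−y)]·Δw(y)` and §1 gives `|∇_μw(x) − ∇_μw(x′)| ≤ C·A′·h·(1 + log⁺((R+1)∕h))` when `|Δw| ≤ A′` on `cube c (R+1)`.
WHAT ([folklore]; 0 def, 0 sorry; every `d ≥ 3`; constants existential in `d`).  **`kernel_row_modulus`** (§1), **`compact_gradient_modulus`** (§2).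
HONEST FRAMING (page 1): flat `ℤ^d` potential theory; nothing of Bałaban's asserted; nothing about minimisers; NOT NE3∕NE7 as spine nodes; spine 0∕9; finite T⁴ rung
(B)+1 — NOT infinite volume, NOT mass gap, NOT BetaPertH, NOT Clay (continuum YM on T⁴ ⇐ BetaPertH ∧ nine spine estimates).
-/

set_option autoImplicit false

open scoped BigOperators
open Finset

namespace Summit.QuantumFields.BalabanUV.T4Continuum.NE7FlatKernelRowModulus

open Literature.MathematicalPhysics.QuantumFieldTheory.Balaban1983to89
open B7Prop1Explicit (Site e)
open Literature.Probability.LatticeModels (latticeLaplacianZd)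
open Beta.PoissonInterior (cube mem_cube cube_mono mem_cube_zero_iff mem_cube_iff_supNorm supNorm supNorm_le_iff natAbs_le_supNorm
  supNorm_eq_zero_iff supNorm_add_le supNorm_neg nrm nrm_pos one_le_nrm supNorm_le_nrm G₀ dG₀ G₀_diff_bound green_rep
  sum_cube_inv_nrm_pow_le)
open NE7FlatGradientModulusPrep (posLog_three_halves_mul_le sum_reflect_le sum_cube_far_inv_nrm_pow_le abs_dG₀_add_sub_le)

noncomputable section

variable {d : ℕ}

/-! ## §1 The dipole-kernel row modulus -/

/-- **THE DIPOLE-KERNEL ROW MODULUS** (`d ≥ 3`): `∃ C ≥ 0` (a function of `d`) such that for every cube `cube c (R+1)`, every direction `μ` and all points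
`x, x′` with `|x′ − c|_∞ ≤ 2R + 2` (`h := |x − x′|_∞`):
`Σ_{y ∈ cube c (R+1)} |dG₀ μ (x − y) − dG₀ μ (x′ − y)| ≤ C·h·(1 + log⁺((R+1)∕h))` (`log⁺ = Real.posLog`; at `h = 0` both sides vanish). [folklore] -/
theorem kernel_row_modulus (hd : 3 ≤ d) : ∃ C : ℝ, 0 ≤ C ∧
    ∀ (c : Site d) (R : ℕ) (x x' : Site d) (μ : Fin d), supNorm (x' - c) ≤ 2 * R + 2 →
      ∑ y ∈ cube c (R + 1), |dG₀ μ (x - y) - dG₀ μ (x' - y)|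
        ≤ C * (supNorm (x - x') : ℝ) * (1 + Real.posLog (((R : ℝ) + 1) / supNorm (x - x'))) := by
  obtain ⟨C₁, hC₁, hG⟩ := G₀_diff_bound hd
  obtain ⟨C₂, hC₂, hK⟩ := abs_dG₀_add_sub_le hd
  have hd0 : 0 < d := by omega
  have hA0 : (0 : ℝ) ≤ 2 * d * 3 ^ (d - 1) := by positivity
  refine ⟨C₁ * (2 + 5 * (2 * d * 3 ^ (d - 1))) + 2 * d * (C₂ * 2 ^ d) * (2 * d * 3 ^ (d - 1)), by positivity,
    fun c R x x' μ hfar => ?_⟩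
  -- `h = 0`
  rcases Nat.eq_zero_or_pos (supNorm (x - x')) with hh0 | hh1
  · have hxx : x = x' := sub_eq_zero.1 (supNorm_eq_zero_iff.1 hh0)
    subst hxx
    simp only [sub_self, abs_zero, Finset.sum_const_zero]
    have : Real.posLog (((R : ℝ) + 1) / (supNorm (0 : Site d) : ℝ)) ≥ 0 := Real.posLog_nonneg
    positivity
  set h : ℕ := supNorm (x - x') with hhdef
  set T := cube c (R + 1) with hTdef
  -- the displacement and its ℓ¹ norm
  set w : Site d := x - x' with hwdef
  have hwi : ∀ i, |w i| ≤ (h : ℤ) := fun i => by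
    have := natAbs_le_supNorm w i
    have h1 : ((w i).natAbs : ℤ) = |w i| := Int.natCast_natAbs (w i)
    omega
  obtain ⟨m, hm⟩ : ∃ m : ℕ, (∑ i, |w i| : ℤ) = m :=
    ⟨(∑ i, |w i|).toNat, (Int.toNat_of_nonneg (Finset.sum_nonneg fun i _ => abs_nonneg _)).symm⟩
  have hmd : (m : ℝ) ≤ d * h := by
    have : (m : ℤ) ≤ d * h := by
      rw [← hm]
      calc (∑ i, |w i| : ℤ) ≤ ∑ _i : Fin d, (h : ℤ) := Finset.sum_le_sum fun i _ => hwi i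
        _ = d * h := by simp
    exact_mod_cast this
  -- FAR FIELD: `2h ≤ |x′ − y|_∞`
  have hfar_pt : ∀ y ∈ T.filter (fun y => 2 * h ≤ supNorm (x' - y)),
      |dG₀ μ (x - y) - dG₀ μ (x' - y)| ≤ d * h * (C₂ * 2 ^ d / nrm (x' - y) ^ d) := by
    intro y hy
    rw [Finset.mem_filter] at hy
    have hxy : x - y = (x' - y) + w := by rw [hwdef]; abel
    have hsup : 2 * (supNorm w : ℝ) ≤ nrm (x' - y) := by
      calc 2 * (supNorm w : ℝ) = ((2 * h : ℕ) : ℝ) := by rw [hwdef, hhdef]; push_cast; ring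
        _ ≤ supNorm (x' - y) := by exact_mod_cast hy.2
        _ ≤ nrm (x' - y) := supNorm_le_nrm _
    rw [hxy]
    calc |dG₀ μ (x' - y + w) - dG₀ μ (x' - y)| ≤ m * (C₂ * 2 ^ d / nrm (x' - y) ^ d) := hK μ m (x' - y) w hm hsup
      _ ≤ d * h * (C₂ * 2 ^ d / nrm (x' - y) ^ d) :=
          mul_le_mul_of_nonneg_right hmd (div_nonneg (by positivity) (pow_nonneg (nrm_pos _).le _))
  have hfar_sum : ∑ y ∈ T.filter (fun y => 2 * h ≤ supNorm (x' - y)), |dG₀ μ (x - y) - dG₀ μ (x' - y)|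
      ≤ d * h * (C₂ * 2 ^ d) * (2 * d * 3 ^ (d - 1) * (1 + Real.posLog (((3 * R + 3 : ℕ) : ℝ) / ((2 * h : ℕ) : ℝ)))) := by
    calc ∑ y ∈ T.filter (fun y => 2 * h ≤ supNorm (x' - y)), |dG₀ μ (x - y) - dG₀ μ (x' - y)|
        ≤ ∑ y ∈ T.filter (fun y => 2 * h ≤ supNorm (x' - y)), d * h * (C₂ * 2 ^ d / nrm (x' - y) ^ d) :=
          Finset.sum_le_sum hfar_pt
      _ = d * h * (C₂ * 2 ^ d) * ∑ y ∈ T.filter (fun y => 2 * h ≤ supNorm (x' - y)), 1 / nrm (x' - y) ^ d := by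
          rw [Finset.mul_sum]
          exact Finset.sum_congr rfl fun y _ => by ring
      _ ≤ d * h * (C₂ * 2 ^ d) * ∑ z ∈ (cube (0 : Site d) (3 * R + 3)).filter (fun z => 2 * h ≤ supNorm z), 1 / nrm z ^ d := by
          apply mul_le_mul_of_nonneg_left _ (by positivity)
          refine sum_reflect_le x' _ _ (fun z => 1 / nrm z ^ d) (fun z => one_div_nonneg.mpr (pow_nonneg (nrm_pos z).le _)) ?_
          intro y hy
          rw [Finset.mem_filter] at hy ⊢
          refine ⟨?_, hy.2⟩
          rw [mem_cube_zero_iff]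
          have h1 : supNorm (x' - y) ≤ supNorm (x' - c) + supNorm (c - y) := by
            simpa using supNorm_add_le (x' - c) (c - y)
          have h2 : supNorm (c - y) = supNorm (y - c) := by rw [← supNorm_neg, neg_sub]
          have h3 : supNorm (y - c) ≤ R + 1 := (mem_cube_iff_supNorm).1 hy.1
          omega
      _ ≤ d * h * (C₂ * 2 ^ d) * (2 * d * 3 ^ (d - 1) * (1 + Real.posLog (((3 * R + 3 : ℕ) : ℝ) / ((2 * h : ℕ) : ℝ)))) :=
          mul_le_mul_of_nonneg_left (sum_cube_far_inv_nrm_pow_le hd0 _ _ (by omega)) (by positivity)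
  -- NEAR FIELD: `|x′ − y|_∞ < 2h`
  have hnear_sum : ∑ y ∈ T.filter (fun y => ¬ 2 * h ≤ supNorm (x' - y)), |dG₀ μ (x - y) - dG₀ μ (x' - y)|
      ≤ C₁ * (1 + 2 * d * 3 ^ (d - 1) * ((3 * h : ℕ) : ℝ)) + C₁ * (1 + 2 * d * 3 ^ (d - 1) * ((2 * h : ℕ) : ℝ)) := by
    have hKb : ∀ v : Site d, |dG₀ μ v| ≤ C₁ / nrm v ^ (d - 1) := fun v => (hG v μ).1
    calc ∑ y ∈ T.filter (fun y => ¬ 2 * h ≤ supNorm (x' - y)), |dG₀ μ (x - y) - dG₀ μ (x' - y)|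
        ≤ ∑ y ∈ T.filter (fun y => ¬ 2 * h ≤ supNorm (x' - y)),
            (C₁ * (1 / nrm (x - y) ^ (d - 1)) + C₁ * (1 / nrm (x' - y) ^ (d - 1))) :=
          Finset.sum_le_sum fun y _ => by
            calc |dG₀ μ (x - y) - dG₀ μ (x' - y)| ≤ |dG₀ μ (x - y)| + |dG₀ μ (x' - y)| := abs_sub _ _
              _ ≤ C₁ / nrm (x - y) ^ (d - 1) + C₁ / nrm (x' - y) ^ (d - 1) := add_le_add (hKb _) (hKb _)
              _ = _ := by ring
      _ = C₁ * ∑ y ∈ T.filter (fun y => ¬ 2 * h ≤ supNorm (x' - y)), 1 / nrm (x - y) ^ (d - 1)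
          + C₁ * ∑ y ∈ T.filter (fun y => ¬ 2 * h ≤ supNorm (x' - y)), 1 / nrm (x' - y) ^ (d - 1) := by
          rw [Finset.sum_add_distrib, Finset.mul_sum, Finset.mul_sum]
      _ ≤ C₁ * ∑ z ∈ cube (0 : Site d) (3 * h), 1 / nrm z ^ (d - 1)
          + C₁ * ∑ z ∈ cube (0 : Site d) (2 * h), 1 / nrm z ^ (d - 1) := by
          apply add_le_add
          · apply mul_le_mul_of_nonneg_left _ hC₁
            refine sum_reflect_le x _ _ (fun z => 1 / nrm z ^ (d - 1))
              (fun z => one_div_nonneg.mpr (pow_nonneg (nrm_pos z).le _)) ?_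
            intro y hy
            rw [Finset.mem_filter] at hy
            rw [mem_cube_zero_iff]
            have h1 : supNorm (x - y) ≤ supNorm (x - x') + supNorm (x' - y) := by
              simpa using supNorm_add_le (x - x') (x' - y)
            omega
          · apply mul_le_mul_of_nonneg_left _ hC₁
            refine sum_reflect_le x' _ _ (fun z => 1 / nrm z ^ (d - 1))
              (fun z => one_div_nonneg.mpr (pow_nonneg (nrm_pos z).le _)) ?_
            intro y hy
            rw [Finset.mem_filter] at hy
            rw [mem_cube_zero_iff]
            omega
      _ ≤ C₁ * (1 + 2 * d * 3 ^ (d - 1) * ((3 * h : ℕ) : ℝ)) + C₁ * (1 + 2 * d * 3 ^ (d - 1) * ((2 * h : ℕ) : ℝ)) := by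
          have e1 : d - (d - 1) = 1 := Nat.sub_sub_self (by omega : 1 ≤ d)
          have h3 := sum_cube_inv_nrm_pow_le (d := d) hd0 (3 * h) (d - 1) le_rfl
          have h2 := sum_cube_inv_nrm_pow_le (d := d) hd0 (2 * h) (d - 1) le_rfl
          rw [e1, pow_one] at h3 h2
          exact add_le_add (mul_le_mul_of_nonneg_left h3 hC₁) (mul_le_mul_of_nonneg_left h2 hC₁)
  -- the whole kernel row
  have hposlog : Real.posLog (((3 * R + 3 : ℕ) : ℝ) / ((2 * h : ℕ) : ℝ)) ≤ 1 + Real.posLog (((R : ℝ) + 1) / h) := by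
    have : ((3 * R + 3 : ℕ) : ℝ) / ((2 * h : ℕ) : ℝ) = 3 / 2 * (((R : ℝ) + 1) / h) := by
      push_cast
      ring
    rw [this]
    exact posLog_three_halves_mul_le (by positivity)
  rw [← Finset.sum_filter_add_sum_filter_not T (fun y => 2 * h ≤ supNorm (x' - y))]
  have hP0 : 0 ≤ Real.posLog (((R : ℝ) + 1) / h) := Real.posLog_nonneg
  have hh0 : (0 : ℝ) ≤ h := by positivity
  -- far ≤ 2·d·C₂·2^d·A · h · (1 + P)
  have hfar' : ∑ y ∈ T.filter (fun y => 2 * h ≤ supNorm (x' - y)), |dG₀ μ (x - y) - dG₀ μ (x' - y)|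
      ≤ 2 * d * (C₂ * 2 ^ d) * (2 * d * 3 ^ (d - 1)) * h * (1 + Real.posLog (((R : ℝ) + 1) / h)) := by
    refine hfar_sum.trans ?_
    have h1 : 1 + Real.posLog (((3 * R + 3 : ℕ) : ℝ) / ((2 * h : ℕ) : ℝ)) ≤ 2 * (1 + Real.posLog (((R : ℝ) + 1) / h)) := by
      linarith
    calc (d : ℝ) * h * (C₂ * 2 ^ d) * (2 * d * 3 ^ (d - 1) * (1 + Real.posLog (((3 * R + 3 : ℕ) : ℝ) / ((2 * h : ℕ) : ℝ))))
        ≤ d * h * (C₂ * 2 ^ d) * (2 * d * 3 ^ (d - 1) * (2 * (1 + Real.posLog (((R : ℝ) + 1) / h)))) :=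
          mul_le_mul_of_nonneg_left (mul_le_mul_of_nonneg_left h1 hA0) (by positivity)
      _ = 2 * d * (C₂ * 2 ^ d) * (2 * d * 3 ^ (d - 1)) * h * (1 + Real.posLog (((R : ℝ) + 1) / h)) := by ring
  -- near ≤ C₁(2 + 5A) · h ≤ C₁(2 + 5A) · h · (1 + P)
  have hnear' : ∑ y ∈ T.filter (fun y => ¬ 2 * h ≤ supNorm (x' - y)), |dG₀ μ (x - y) - dG₀ μ (x' - y)|
      ≤ C₁ * (2 + 5 * (2 * d * 3 ^ (d - 1))) * h * (1 + Real.posLog (((R : ℝ) + 1) / h)) := by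
    refine hnear_sum.trans ?_
    have hh1r : (1 : ℝ) ≤ h := by exact_mod_cast hh1
    have h1 : C₁ * (1 + 2 * d * 3 ^ (d - 1) * ((3 * h : ℕ) : ℝ)) + C₁ * (1 + 2 * d * 3 ^ (d - 1) * ((2 * h : ℕ) : ℝ))
        = C₁ * (2 + 5 * (2 * d * 3 ^ (d - 1)) * h) := by push_cast; ring
    have h2 : (2 : ℝ) + 5 * (2 * d * 3 ^ (d - 1)) * h ≤ (2 + 5 * (2 * d * 3 ^ (d - 1))) * h := by nlinarith
    rw [h1]
    calc C₁ * (2 + 5 * (2 * d * 3 ^ (d - 1)) * h) ≤ C₁ * ((2 + 5 * (2 * d * 3 ^ (d - 1))) * h) :=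
          mul_le_mul_of_nonneg_left h2 hC₁
      _ = C₁ * (2 + 5 * (2 * d * 3 ^ (d - 1))) * h * 1 := by ring
      _ ≤ C₁ * (2 + 5 * (2 * d * 3 ^ (d - 1))) * h * (1 + Real.posLog (((R : ℝ) + 1) / h)) :=
          mul_le_mul_of_nonneg_left (by linarith) (by positivity)
  calc _ ≤ _ := add_le_add hfar' hnear'
    _ = _ := by ring

/-! ## §2 The gradient of a compactly supported scalar function with bounded Laplacian -/

/-- **LOG-LIPSCHITZ MODULUS OF THE GRADIENT, COMPACT SUPPORT** (`d ≥ 3`): `∃ C ≥ 0` (a function of `d`) such that for every scalar lattice function `w`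
vanishing off `cube c R` with `|Δw| ≤ A′` on `cube c (R+1)`, every direction `μ` and all points `x, x′` with `|x′ − c|_∞ ≤ 2R + 2` (`h := |x − x′|_∞`):
`|(w(x + e_μ) − w(x)) − (w(x′ + e_μ) − w(x′))| ≤ C·A′·h·(1 + log⁺((R+1)∕h))` — `w` is the Newtonian potential of `−Δw` (pv23's `green_rep`) and §1 bounds the
kernel row. [folklore] -/
theorem compact_gradient_modulus (hd : 3 ≤ d) : ∃ C : ℝ, 0 ≤ C ∧
    ∀ (c : Site d) (R : ℕ) (w : Site d → ℝ), (∀ y, y ∉ cube c R → w y = 0) →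
      ∀ (A' : ℝ), (∀ y ∈ cube c (R + 1), |latticeLaplacianZd w y| ≤ A') →
      ∀ (x x' : Site d) (μ : Fin d), supNorm (x' - c) ≤ 2 * R + 2 →
        |(w (x + e μ) - w x) - (w (x' + e μ) - w x')|
          ≤ C * A' * (supNorm (x - x') : ℝ) * (1 + Real.posLog (((R : ℝ) + 1) / supNorm (x - x'))) := by
  obtain ⟨C, hC, hrow⟩ := kernel_row_modulus hd
  refine ⟨C, hC, fun c R w hw A' hA x x' μ hx' => ?_⟩
  set T := cube c (R + 1) with hTdef
  -- the dipole representation of one increment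
  have hrep : ∀ x₀ : Site d, w (x₀ + e μ) - w x₀ = -∑ y ∈ T, dG₀ μ (x₀ - y) * latticeLaplacianZd w y := by
    intro x₀
    have e1 : w (x₀ + e μ) = -∑ y ∈ T, G₀ (x₀ + e μ - y) * latticeLaplacianZd w y := green_rep hd c R w hw (x₀ + e μ)
    have e2 : w x₀ = -∑ y ∈ T, G₀ (x₀ - y) * latticeLaplacianZd w y := green_rep hd c R w hw x₀
    rw [e1, e2, neg_sub_neg, ← Finset.sum_sub_distrib, ← Finset.sum_neg_distrib]
    refine Finset.sum_congr rfl fun y _ => ?_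
    have hy : G₀ (x₀ + e μ - y) = G₀ (x₀ - y + Pi.single μ 1) := by
      rw [show x₀ + e μ - y = x₀ - y + e μ by abel]
      rfl
    rw [hy, dG₀]
    ring
  have hdiff : (w (x + e μ) - w x) - (w (x' + e μ) - w x')
      = -∑ y ∈ T, (dG₀ μ (x - y) - dG₀ μ (x' - y)) * latticeLaplacianZd w y := by
    rw [hrep x, hrep x']
    simp only [sub_mul, Finset.sum_sub_distrib]
    ring
  have hA0 : 0 ≤ A' := by
    have hc : c ∈ cube c (R + 1) := by rw [mem_cube]; intro i; simp; positivity
    exact (abs_nonneg _).trans (hA c hc)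
  rw [hdiff, abs_neg]
  calc |∑ y ∈ T, (dG₀ μ (x - y) - dG₀ μ (x' - y)) * latticeLaplacianZd w y|
      ≤ ∑ y ∈ T, |(dG₀ μ (x - y) - dG₀ μ (x' - y)) * latticeLaplacianZd w y| := Finset.abs_sum_le_sum_abs _ _
    _ ≤ ∑ y ∈ T, |dG₀ μ (x - y) - dG₀ μ (x' - y)| * A' :=
        Finset.sum_le_sum fun y hy => by
          rw [abs_mul]
          exact mul_le_mul_of_nonneg_left (hA y hy) (abs_nonneg _)
    _ = (∑ y ∈ T, |dG₀ μ (x - y) - dG₀ μ (x' - y)|) * A' := by rw [Finset.sum_mul]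
    _ ≤ C * (supNorm (x - x') : ℝ) * (1 + Real.posLog (((R : ℝ) + 1) / supNorm (x - x'))) * A' :=
        mul_le_mul_of_nonneg_right (hrow c R x x' μ hx') hA0
    _ = _ := by ring

end

end Summit.QuantumFields.BalabanUV.T4Continuum.NE7FlatKernelRowModulus
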